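import Summits.CriticalPhenomena.SAWScalingLimit.Theses.SAWReversalUpgrade
import Summits.CriticalPhenomena.SAWScalingLimit.Theorems.SAWCircleScreeningScreeningRecursionWalks
import Literature.Barriers.CriticalPhenomena.SupercriticalSAWSpaceFillingEstimates
import HarnessLib

/-!
# `NoDeepReturn`, line `naked-root-localisation` (SketchIdeator2): stub `stub_firstEntranceFarBound`
(item stmt-CriticalPhenomena-18004, route SAWReversalUpgrade; stub 3 of 5 — the (★)-engine)

**First-entrance decomposition of the critical SAW weight.** Fix a discrete domain `Ω_δ`
(`Ω` bounded, `δ > 0`), endpoints `u v`, an ENTRANCE PREDICATE `A` on lattice sites with `A v`,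
a centre `c`, a radius `ε` and `η ≥ 0`. Hypothesis: from every `A`-vertex `y`, the `x_c`-mass of
the SAWs `y → v` visiting a vertex `ε`-far from `c` is at most `η` times the mass of the SAWs
`y → v` all of whose vertices satisfy `A`. Conclusion: under the critical law `u → v`, the event
`E` = "some vertex `γ_i ∈ A` and a LATER vertex `γ_j` (`i < j ≤ |γ|`) `ε`-far from `c`" has
probability `≤ η`.

Proof (lattice combinatorics only). Every SAW `γ : u → v` has a first index `k = fe γ` with
`A (γ_k)` (it exists since `γ_{|γ|} = v ∈ A`); its first-entrance prefix is the vertex list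
`pl γ = [γ_0, …, γ_k]`. The fibres `{pl = p}` partition the (finite) SAW space, so it suffices to
prove `W(E ∩ {pl = pl γ₀}) ≤ η · W{pl = pl γ₀}` for every `γ₀` and to sum
(`measure_biUnion_finset_le`, `sum_measure_preimage_singleton`). With `k₀ = fe γ₀`,
`y₀ = (γ₀)_{k₀}`, `pre = [γ₀_0, …, γ₀_{k₀ - 1}]`:

* every `γ` in the fibre splits as `support γ = pre ++ support ρ` with `ρ = γ|_{[k₀, |γ|]}` a SAW
  `y₀ → v` (`firstEntrance_exists_tail`), and if `γ ∈ E` then `ρ` visits an `ε`-far vertex (the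
  `A`-vertex `γ_i` of the event has `i ≥ k₀` by minimality, so `j > k₀`); as
  `x_c^{|γ|} = x_c^{|pre|} x_c^{|ρ|}` and `γ ↦ ρ` is injective on the fibre,
  `W(E ∩ fibre) ≤ x_c^{|pre|} W_{y₀ → v}(far)` (`firstEntrance_weight_le_mul_weight`);
* every `A`-confined SAW `ρ : y₀ → v` glues onto the prefix: `pre` has no `A`-vertex, `ρ` has
  only `A`-vertices, so `pre ++ support ρ` is again self-avoiding (`firstEntrance_exists_glue`),
  it lies in the fibre, and `ρ ↦ glued` is injective:
  `x_c^{|pre|} W_{y₀ → v}(A-confined) ≤ W(fibre)` (`firstEntrance_mul_weight_le_weight`);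
* the hypothesis at `y₀ ∈ A` links the two:
  `W(E ∩ fibre) ≤ x_c^{|pre|} η W(A-confined) ≤ η W(fibre)`.

Finally `law E = Z⁻¹ W(E) ≤ Z⁻¹ η Z = η` (`Z < ∞` by `ScreeningRecursion.weight_univ_ne_top`;
`Z = 0` trivial). Folklore (configurational structure of the weights `x_c^{|γ|}`, Madras–Slade
1993 §1.2);
Mathlib anchors: `SimpleGraph.Walk.take`/`drop`, `ENNReal.tsum_comp_le_tsum_of_injective`,
`tsum_subtype`, `MeasureTheory.sum_measure_preimage_singleton`; `0 ≤ x_c` is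
`SupercriticalSAW.criticalFugacity_nonneg` (barrier file `SupercriticalSAWSpaceFillingEstimates`).

Not here: the other four stubs of the line and the glue.
-/

noncomputable section

namespace Summit.CriticalPhenomena.SAWScalingLimit.Theorems.NoDeepReturn.NakedRoot

open MeasureTheory Filter Topology Set Metric
open scoped ENNReal
open Literature.Probability.LatticeModels (Site meshPoint discreteDomainGraph)
open Literature.Probability.RandomPlanarGeometry
open Literature.Probability.RandomPlanarGeometry.SAW
open Literature.Barriers.CriticalPhenomena.SupercriticalSAW (criticalFugacity_nonneg)

variable {Ω : Set ℂ} {δ : ℝ}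

/-! ## Weighted injections along support concatenation -/

/-- If the support of `γ` is `pre ++ support ρ` then `|γ| = |pre| + |ρ|`. -/
theorem firstEntrance_length_eq_of_support_eq {a b a' b' : Site 2} {pre : List (Site 2)}
    {γ : DomainSAW Ω δ a b} {ρ : DomainSAW Ω δ a' b'}
    (h : γ.walk.support = pre ++ ρ.walk.support) : γ.length = pre.length + ρ.length := by
  have h1 := congrArg List.length h
  rw [SimpleGraph.Walk.length_support, List.length_append, SimpleGraph.Walk.length_support] at h1
  show γ.walk.length = pre.length + ρ.walk.length
  omega

/-- **Weighted injection, upper bound.** If every SAW of `S` has support `pre ++ support ρ` for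
some `ρ ∈ T`, then `W(S) ≤ x_c^{|pre|} · W(T)` (the map `γ ↦ ρ` is injective since a SAW is
determined by its support, and `x_c^{|γ|} = x_c^{|pre|} x_c^{|ρ|}`). -/
theorem firstEntrance_weight_le_mul_weight {a b a' b' : Site 2} (pre : List (Site 2))
    {S : Set (DomainSAW Ω δ a b)} {T : Set (DomainSAW Ω δ a' b')}
    (h : ∀ γ ∈ S, ∃ ρ ∈ T, γ.walk.support = pre ++ ρ.walk.support) :
    weight Ω δ a b S ≤
      ENNReal.ofReal (criticalFugacity ^ pre.length) * weight Ω δ a' b' T := by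
  classical
  rw [weight_apply_eq_tsum_indicator, weight_apply_eq_tsum_indicator,
    ← tsum_subtype S (fun γ => ENNReal.ofReal (criticalFugacity ^ γ.length)),
    ← ENNReal.tsum_mul_left]
  have hex : ∀ γ : S, ∃ ρ : DomainSAW Ω δ a' b', ρ ∈ T ∧
      γ.1.walk.support = pre ++ ρ.walk.support := fun γ => h γ.1 γ.2
  choose κ hκT hκ using hex
  have hinj : Function.Injective κ := by
    intro γ₁ γ₂ hγ
    apply Subtype.ext
    apply DomainSAW.ext_support
    rw [hκ γ₁, hκ γ₂, hγ]
  calc ∑' γ : S, ENNReal.ofReal (criticalFugacity ^ γ.1.length)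
      = ∑' γ : S, ENNReal.ofReal (criticalFugacity ^ pre.length) *
          T.indicator (fun ρ => ENNReal.ofReal (criticalFugacity ^ ρ.length)) (κ γ) := by
        refine tsum_congr fun γ => ?_
        rw [indicator_of_mem (hκT γ), firstEntrance_length_eq_of_support_eq (hκ γ), pow_add,
          ENNReal.ofReal_mul (pow_nonneg criticalFugacity_nonneg _)]
    _ ≤ ∑' ρ, ENNReal.ofReal (criticalFugacity ^ pre.length) *
          T.indicator (fun ρ => ENNReal.ofReal (criticalFugacity ^ ρ.length)) ρ :=
        ENNReal.tsum_comp_le_tsum_of_injective hinj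
          (fun ρ => ENNReal.ofReal (criticalFugacity ^ pre.length) *
            T.indicator (fun ρ => ENNReal.ofReal (criticalFugacity ^ ρ.length)) ρ)

/-- **Weighted injection, lower bound.** If every SAW `ρ ∈ T` glues to a SAW of `S` with support
`pre ++ support ρ`, then `x_c^{|pre|} · W(T) ≤ W(S)` (the gluing is injective by
`List.append_cancel_left`). -/
theorem firstEntrance_mul_weight_le_weight {a b a' b' : Site 2} (pre : List (Site 2))
    {S : Set (DomainSAW Ω δ a b)} {T : Set (DomainSAW Ω δ a' b')}
    (h : ∀ ρ ∈ T, ∃ γ ∈ S, γ.walk.support = pre ++ ρ.walk.support) :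
    ENNReal.ofReal (criticalFugacity ^ pre.length) * weight Ω δ a' b' T ≤
      weight Ω δ a b S := by
  classical
  rw [weight_apply_eq_tsum_indicator, weight_apply_eq_tsum_indicator,
    ← tsum_subtype T (fun ρ => ENNReal.ofReal (criticalFugacity ^ ρ.length)),
    ← ENNReal.tsum_mul_left]
  have hex : ∀ ρ : T, ∃ γ : DomainSAW Ω δ a b, γ ∈ S ∧
      γ.walk.support = pre ++ ρ.1.walk.support := fun ρ => h ρ.1 ρ.2
  choose ι hιS hι using hex
  have hinj : Function.Injective ι := by
    intro ρ₁ ρ₂ hρ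
    apply Subtype.ext
    apply DomainSAW.ext_support
    have h1 := hι ρ₁
    rw [hρ, hι ρ₂] at h1
    exact (List.append_cancel_left h1).symm
  calc ∑' ρ : T, ENNReal.ofReal (criticalFugacity ^ pre.length) *
        ENNReal.ofReal (criticalFugacity ^ ρ.1.length)
      = ∑' ρ : T, S.indicator (fun γ => ENNReal.ofReal (criticalFugacity ^ γ.length)) (ι ρ) := by
        refine tsum_congr fun ρ => ?_
        rw [indicator_of_mem (hιS ρ), firstEntrance_length_eq_of_support_eq (hι ρ), pow_add,
          ENNReal.ofReal_mul (pow_nonneg criticalFugacity_nonneg _)]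
    _ ≤ ∑' γ, S.indicator (fun γ => ENNReal.ofReal (criticalFugacity ^ γ.length)) γ :=
        ENNReal.tsum_comp_le_tsum_of_injective hinj _

/-! ## Cutting a SAW at an index and gluing onto a first-entrance prefix -/

/-- **The tail of a SAW.** The sub-walk `γ|_{[k, |γ|]}` of a SAW from its `k`-th vertex `y`
(`k ≤ |γ|`) is a SAW `ρ : y → b` with `support γ = (support γ).take k ++ support ρ`,
`|ρ| = |γ| - k` and `ρ_m = γ_{k + m}` (Mathlib `SimpleGraph.Walk.drop`). -/
theorem firstEntrance_exists_tail {a b : Site 2} (γ : DomainSAW Ω δ a b) {k : ℕ}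
    (hk : k ≤ γ.walk.length) {y : Site 2} (hy : γ.walk.getVert k = y) :
    ∃ ρ : DomainSAW Ω δ y b, γ.walk.support = γ.walk.support.take k ++ ρ.walk.support ∧
      ρ.walk.length = γ.walk.length - k ∧ ∀ m, ρ.walk.getVert m = γ.walk.getVert (k + m) := by
  subst hy
  refine ⟨⟨γ.walk.drop k, ?_⟩, ?_, ?_, ?_⟩
  · rw [SimpleGraph.Walk.isPath_def, SimpleGraph.Walk.drop_support_eq_support_drop_min]
    exact ((SimpleGraph.Walk.isPath_def _).1 γ.isPath).sublist (List.drop_sublist _ _)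
  · show γ.walk.support = γ.walk.support.take k ++ (γ.walk.drop k).support
    rw [SimpleGraph.Walk.drop_support_eq_support_drop_min, Nat.min_eq_left hk,
      List.take_append_drop]
  · show (γ.walk.drop k).length = γ.walk.length - k
    exact SimpleGraph.Walk.drop_length _ _
  · intro m
    show (γ.walk.drop k).getVert m = γ.walk.getVert (k + m)
    exact SimpleGraph.Walk.drop_getVert _ _ _

/-- **Gluing onto a first-entrance prefix.** Let `γ₀` be a SAW `a → b`, `k ≤ |γ₀|`, `y = (γ₀)_k`,
and suppose no vertex `(γ₀)_i`, `i < k`, satisfies `A`. Then for every SAW `ρ : y → b` all of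
whose vertices satisfy `A`, the concatenation `γ₀|_{[0,k]} ++ ρ` is a SAW `γ : a → b` (the two
pieces meet only at `y`: the prefix has no `A`-vertex, `ρ` has only `A`-vertices), with
`support γ = (support γ₀).take k ++ support ρ = (support γ₀).take (k+1) ++ (support ρ).tail`,
`γ_i = (γ₀)_i` for `i < k` and `γ_{k+m} = ρ_m`. -/
theorem firstEntrance_exists_glue {a b : Site 2} (A : Site 2 → Prop) (γ₀ : DomainSAW Ω δ a b)
    {k : ℕ} (hk : k ≤ γ₀.walk.length) {y : Site 2} (hy : γ₀.walk.getVert k = y)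
    (hpre : ∀ i < k, ¬ A (γ₀.walk.getVert i)) (ρ : DomainSAW Ω δ y b)
    (hρ : ∀ j ≤ ρ.walk.length, A (ρ.walk.getVert j)) :
    ∃ γ : DomainSAW Ω δ a b, γ.walk.support = γ₀.walk.support.take k ++ ρ.walk.support ∧
      γ.walk.support = γ₀.walk.support.take (k + 1) ++ ρ.walk.support.tail ∧
      (∀ i < k, γ.walk.getVert i = γ₀.walk.getVert i) ∧
      ∀ m, γ.walk.getVert (k + m) = ρ.walk.getVert m := by
  subst hy
  have hsupp : ((γ₀.walk.take k).append ρ.walk).support =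
      γ₀.walk.support.take k ++ ρ.walk.support := by
    rw [SimpleGraph.Walk.support_append_eq_support_dropLast_append, SimpleGraph.Walk.support_take,
      List.dropLast_eq_take, List.take_take, List.length_take, SimpleGraph.Walk.length_support]
    congr 2
    omega
  have hsupp' : ((γ₀.walk.take k).append ρ.walk).support =
      γ₀.walk.support.take (k + 1) ++ ρ.walk.support.tail := by
    rw [SimpleGraph.Walk.support_append, SimpleGraph.Walk.support_take]
  have hlen : (γ₀.walk.take k).length = k := by
    rw [SimpleGraph.Walk.take_length, Nat.min_eq_left hk]
  refine ⟨⟨(γ₀.walk.take k).append ρ.walk, ?_⟩, hsupp, hsupp', ?_, ?_⟩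
  · rw [SimpleGraph.Walk.isPath_def, hsupp, List.nodup_append]
    refine ⟨((SimpleGraph.Walk.isPath_def _).1 γ₀.isPath).sublist (List.take_sublist _ _),
      (SimpleGraph.Walk.isPath_def _).1 ρ.isPath, ?_⟩
    intro x hx z hz hxz
    subst hxz
    obtain ⟨i, hi, rfl⟩ := List.mem_take_iff_getElem.1 hx
    obtain ⟨j, hj, hjlen⟩ := SimpleGraph.Walk.mem_support_iff_exists_getVert.1 hz
    have hik : i < k := (lt_min_iff.1 hi).1
    rw [SimpleGraph.Walk.support_getElem_eq_getVert] at hj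
    exact hpre i hik (hj ▸ hρ j hjlen)
  · intro i hi
    show ((γ₀.walk.take k).append ρ.walk).getVert i = γ₀.walk.getVert i
    rw [SimpleGraph.Walk.getVert_append, if_pos (by rw [hlen]; exact hi),
      SimpleGraph.Walk.take_getVert, Nat.min_eq_right hi.le]
  · intro m
    show ((γ₀.walk.take k).append ρ.walk).getVert (k + m) = ρ.walk.getVert m
    rw [SimpleGraph.Walk.getVert_append, if_neg (by rw [hlen]; omega), hlen,
      Nat.add_sub_cancel_left]

/-! ## First-entrance index and its fibres -/

/-- **First-entrance index.** If `A b` then every SAW `γ : a → b` has a least index `k` with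
`A (γ_k)` (`γ_{|γ|} = b`; `Nat.find`). -/
theorem firstEntrance_exists_index {a b : Site 2} (A : Site 2 → Prop) (hb : A b)
    (γ : DomainSAW Ω δ a b) :
    ∃ k, A (γ.walk.getVert k) ∧ ∀ i, A (γ.walk.getVert i) → k ≤ i := by
  classical
  have h : ∃ i, A (γ.walk.getVert i) :=
    ⟨γ.walk.length, by rw [SimpleGraph.Walk.getVert_length]; exact hb⟩
  exact ⟨Nat.find h, Nat.find_spec h, fun i hi => Nat.find_min' h hi⟩

/-- **Two SAWs in the same fibre.** If `(support γ).take (k+1) = (support γ₀).take (k₀+1)` with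
`k ≤ |γ|`, `k₀ ≤ |γ₀|`, then `k = k₀`, `γ_{k₀} = (γ₀)_{k₀}` and
`(support γ).take k₀ = (support γ₀).take k₀`. -/
theorem firstEntrance_of_take_succ_eq {a b : Site 2} {γ γ₀ : DomainSAW Ω δ a b} {k k₀ : ℕ}
    (hk : k ≤ γ.walk.length) (hk₀ : k₀ ≤ γ₀.walk.length)
    (h : γ.walk.support.take (k + 1) = γ₀.walk.support.take (k₀ + 1)) :
    k = k₀ ∧ γ.walk.getVert k₀ = γ₀.walk.getVert k₀ ∧
      γ.walk.support.take k₀ = γ₀.walk.support.take k₀ := by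
  have hlen : k = k₀ := by
    have h1 := congrArg List.length h
    rw [List.length_take, List.length_take, SimpleGraph.Walk.length_support,
      SimpleGraph.Walk.length_support] at h1
    omega
  rw [hlen] at h hk
  refine ⟨hlen, ?_, ?_⟩
  · have h1 := SimpleGraph.Walk.getVert_eq_support_getElem? γ.walk hk
    have h2 := SimpleGraph.Walk.getVert_eq_support_getElem? γ₀.walk hk₀
    rw [← List.getElem?_take_of_lt (Nat.lt_succ_self k₀), h,
      List.getElem?_take_of_lt (Nat.lt_succ_self k₀), ← h2] at h1
    exact Option.some_injective _ h1
  · have h1 := congrArg (List.take k₀) h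
    rwa [List.take_take, List.take_take, Nat.min_eq_left (Nat.le_succ k₀)] at h1

/-- **The fibrewise bound.** Let `fe` be the first-entrance index (characterised by `A (γ_{fe γ})`
and minimality) and `pl γ = (support γ).take (fe γ + 1)` the first-entrance prefix. If at the tip
`y₀ = (γ₀)_{fe γ₀}` the far mass is at most `η` times the `A`-confined mass, then
`W(E ∩ {pl = pl γ₀}) ≤ η · W{pl = pl γ₀}` (cut at `fe`, far tail; glue `A`-confined tails). -/
theorem firstEntrance_weight_inter_fiber_le {a b : Site 2} (A : Site 2 → Prop) (hb : A b)
    (c : ℂ) (ε η : ℝ) (fe : DomainSAW Ω δ a b → ℕ)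
    (hfeA : ∀ γ : DomainSAW Ω δ a b, A (γ.walk.getVert (fe γ)))
    (hfemin : ∀ (γ : DomainSAW Ω δ a b) (i : ℕ), A (γ.walk.getVert i) → fe γ ≤ i)
    (pl : DomainSAW Ω δ a b → List (Site 2))
    (hpl : ∀ γ : DomainSAW Ω δ a b, pl γ = γ.walk.support.take (fe γ + 1))
    (γ₀ : DomainSAW Ω δ a b)
    (hyp : weight Ω δ (γ₀.walk.getVert (fe γ₀)) b
        {ρ | ∃ j ≤ ρ.walk.length, ε ≤ dist (meshPoint δ (ρ.walk.getVert j)) c} ≤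
      ENNReal.ofReal η * weight Ω δ (γ₀.walk.getVert (fe γ₀)) b
        {ρ | ∀ j ≤ ρ.walk.length, A (ρ.walk.getVert j)}) :
    weight Ω δ a b ({γ | ∃ i j : ℕ, i < j ∧ j ≤ γ.walk.length ∧ A (γ.walk.getVert i) ∧
        ε ≤ dist (meshPoint δ (γ.walk.getVert j)) c} ∩ pl ⁻¹' {pl γ₀}) ≤
      ENNReal.ofReal η * weight Ω δ a b (pl ⁻¹' {pl γ₀}) := by
  have hk₀ : fe γ₀ ≤ γ₀.walk.length :=
    hfemin γ₀ _ (by rw [SimpleGraph.Walk.getVert_length]; exact hb)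
  have hnotA : ∀ i < fe γ₀, ¬ A (γ₀.walk.getVert i) := fun i hi hA =>
    absurd (hfemin γ₀ i hA) (not_le.2 hi)
  -- (a) cut at the first entrance: on the event the tail is far
  have ha : weight Ω δ a b ({γ | ∃ i j : ℕ, i < j ∧ j ≤ γ.walk.length ∧ A (γ.walk.getVert i) ∧
        ε ≤ dist (meshPoint δ (γ.walk.getVert j)) c} ∩ pl ⁻¹' {pl γ₀}) ≤
      ENNReal.ofReal (criticalFugacity ^ (γ₀.walk.support.take (fe γ₀)).length) *
        weight Ω δ (γ₀.walk.getVert (fe γ₀)) b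
          {ρ | ∃ j ≤ ρ.walk.length, ε ≤ dist (meshPoint δ (ρ.walk.getVert j)) c} := by
    refine firstEntrance_weight_le_mul_weight _ ?_
    rintro γ ⟨⟨i, j, hij, hj, hAi, hfar⟩, hγ⟩
    have hγ' : pl γ = pl γ₀ := hγ
    rw [hpl, hpl] at hγ'
    have hkγ : fe γ ≤ γ.walk.length :=
      hfemin γ _ (by rw [SimpleGraph.Walk.getVert_length]; exact hb)
    obtain ⟨hfe, hy, htake⟩ := firstEntrance_of_take_succ_eq hkγ hk₀ hγ'
    obtain ⟨ρ, hsupp, hlen, hvert⟩ := firstEntrance_exists_tail γ (hfe ▸ hkγ) hy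
    have hfei : fe γ ≤ i := hfemin γ i hAi
    refine ⟨ρ, ⟨j - fe γ₀, by omega, ?_⟩, by rw [hsupp, htake]⟩
    rw [hvert, Nat.add_sub_cancel' (show fe γ₀ ≤ j by omega)]
    exact hfar
  -- (b) glue the `A`-confined tails onto the prefix
  have hb' : ENNReal.ofReal (criticalFugacity ^ (γ₀.walk.support.take (fe γ₀)).length) *
      weight Ω δ (γ₀.walk.getVert (fe γ₀)) b {ρ | ∀ j ≤ ρ.walk.length, A (ρ.walk.getVert j)} ≤
      weight Ω δ a b (pl ⁻¹' {pl γ₀}) := by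
    refine firstEntrance_mul_weight_le_weight _ ?_
    intro ρ hρ
    obtain ⟨γ, hsupp, hsupp', hvert, hvert'⟩ := firstEntrance_exists_glue A γ₀ hk₀ rfl hnotA ρ hρ
    refine ⟨γ, ?_, hsupp⟩
    show pl γ = pl γ₀
    have hfeγ : fe γ = fe γ₀ := by
      apply le_antisymm
      · apply hfemin
        have h0 := hvert' 0
        rw [Nat.add_zero, SimpleGraph.Walk.getVert_zero] at h0
        rw [h0]
        exact hfeA γ₀
      · by_contra hlt
        exact hnotA (fe γ) (not_le.1 hlt) (by rw [← hvert _ (not_le.1 hlt)]; exact hfeA γ)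
    rw [hpl, hpl, hfeγ, hsupp', List.take_left']
    rw [List.length_take, SimpleGraph.Walk.length_support]
    omega
  calc _ ≤ _ := ha
    _ ≤ ENNReal.ofReal (criticalFugacity ^ (γ₀.walk.support.take (fe γ₀)).length) *
        (ENNReal.ofReal η * weight Ω δ (γ₀.walk.getVert (fe γ₀)) b
          {ρ | ∀ j ≤ ρ.walk.length, A (ρ.walk.getVert j)}) := by gcongr
    _ = ENNReal.ofReal η *
        (ENNReal.ofReal (criticalFugacity ^ (γ₀.walk.support.take (fe γ₀)).length) *
          weight Ω δ (γ₀.walk.getVert (fe γ₀)) b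
            {ρ | ∀ j ≤ ρ.walk.length, A (ρ.walk.getVert j)}) := by ring
    _ ≤ ENNReal.ofReal η * weight Ω δ a b (pl ⁻¹' {pl γ₀}) := by gcongr

/-! ## The stub -/

/-- **Stub 3 of line `naked-root-localisation` (first-entrance far bound, the (★)-engine).** For
an ARBITRARY entrance predicate `A ∋ v`: if from every `A`-vertex `y` the `x_c`-mass of walks
`y → v` visiting a vertex `ε`-far from `c` is at most `η` times the mass of the walks `y → v` all
of whose vertices satisfy `A`, then under the critical law from `u` to `v` the event "some vertex
in `A`, a LATER vertex `ε`-far from `c`" has probability `≤ η`. Proof: partition by the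
first-entrance prefix (`firstEntrance_weight_inter_fiber_le` on each fibre, summed over the finite
set of fibres), then normalise (`law = Z⁻¹ · weight`, `Z < ∞`). -/
theorem stub_firstEntranceFarBound :
    ∀ (Ω : Set ℂ), Bornology.IsBounded Ω → ∀ (δ : ℝ), 0 < δ →
      ∀ (u v : Site 2) (A : Site 2 → Prop) (c : ℂ) (ε η : ℝ), 0 ≤ η → A v →
      (∀ y : Site 2, A y →
        weight Ω δ y v {γ | ∃ j ≤ γ.walk.length, ε ≤ dist (meshPoint δ (γ.walk.getVert j)) c} ≤
          ENNReal.ofReal η *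
            weight Ω δ y v {γ | ∀ j ≤ γ.walk.length, A (γ.walk.getVert j)}) →
      law Ω δ u v {γ | ∃ i j : ℕ, i < j ∧ j ≤ γ.walk.length ∧ A (γ.walk.getVert i) ∧
        ε ≤ dist (meshPoint δ (γ.walk.getVert j)) c} ≤ ENNReal.ofReal η := by
  intro Ω hΩ δ hδ u v A c ε η _ hv hyp
  classical
  choose fe hfeA hfemin using fun γ : DomainSAW Ω δ u v => firstEntrance_exists_index A hv γ
  obtain ⟨pl, hpl⟩ : ∃ pl : DomainSAW Ω δ u v → List (Site 2),
      ∀ γ : DomainSAW Ω δ u v, pl γ = γ.walk.support.take (fe γ + 1) := ⟨_, fun γ => rfl⟩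
  haveI : Finite (DomainSAW Ω δ u v) := TPToTraversalBound.Radial.finite_domainSAW hΩ hδ u v
  haveI : Fintype (DomainSAW Ω δ u v) := Fintype.ofFinite _
  set E : Set (DomainSAW Ω δ u v) := {γ | ∃ i j : ℕ, i < j ∧ j ≤ γ.walk.length ∧
    A (γ.walk.getVert i) ∧ ε ≤ dist (meshPoint δ (γ.walk.getVert j)) c} with hE
  set S : Finset (List (Site 2)) := Finset.univ.image pl with hS
  -- the weight bound, fibre by fibre
  have hkey : weight Ω δ u v E ≤ ENNReal.ofReal η * weight Ω δ u v univ := by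
    have hcover : E ⊆ ⋃ p ∈ S, E ∩ pl ⁻¹' {p} := fun γ hγ =>
      Set.mem_iUnion₂.2 ⟨pl γ, Finset.mem_image_of_mem pl (Finset.mem_univ γ), hγ, rfl⟩
    calc weight Ω δ u v E ≤ weight Ω δ u v (⋃ p ∈ S, E ∩ pl ⁻¹' {p}) := measure_mono hcover
      _ ≤ ∑ p ∈ S, weight Ω δ u v (E ∩ pl ⁻¹' {p}) := measure_biUnion_finset_le S _
      _ ≤ ∑ p ∈ S, ENNReal.ofReal η * weight Ω δ u v (pl ⁻¹' {p}) := by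
          refine Finset.sum_le_sum fun p hp => ?_
          obtain ⟨γ₀, -, rfl⟩ := Finset.mem_image.1 hp
          exact firstEntrance_weight_inter_fiber_le A hv c ε η fe hfeA hfemin pl hpl γ₀
            (hyp _ (hfeA γ₀))
      _ = ENNReal.ofReal η * ∑ p ∈ S, weight Ω δ u v (pl ⁻¹' {p}) := by rw [Finset.mul_sum]
      _ = ENNReal.ofReal η * weight Ω δ u v (pl ⁻¹' ↑S) := by
          rw [sum_measure_preimage_singleton S fun _ _ => MeasurableSpace.measurableSet_top]
      _ ≤ ENNReal.ofReal η * weight Ω δ u v univ := by gcongr; exact subset_univ _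
  -- normalise
  rw [law_apply_eq_inv_mul_weight]
  have hZtop : weight Ω δ u v univ ≠ ⊤ := ScreeningRecursion.weight_univ_ne_top hΩ hδ u v
  by_cases hZ0 : weight Ω δ u v univ = 0
  · rw [measure_mono_null (subset_univ E) hZ0, mul_zero]
    exact bot_le
  · calc (weight Ω δ u v univ)⁻¹ * weight Ω δ u v E
        ≤ (weight Ω δ u v univ)⁻¹ * (ENNReal.ofReal η * weight Ω δ u v univ) := by gcongr
      _ = ENNReal.ofReal η * ((weight Ω δ u v univ)⁻¹ * weight Ω δ u v univ) := by ring
      _ = ENNReal.ofReal η := by rw [ENNReal.inv_mul_cancel hZ0 hZtop, mul_one]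

end Summit.CriticalPhenomena.SAWScalingLimit.Theorems.NoDeepReturn.NakedRoot

end
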